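import Mathlib
import HarnessLib

/-!
# Stub B `stub_abelFloor_of_windowLimits` of line `natural-scale-poisson-sandwich`
(crux `EmbeddedDrudeMourre.DrudeDissolution`, item stmt-AtomisticToContinuum-12593; `--supports` file
proving the registered stub B verbatim, closes nothing)

WHAT. Abel summation of kinetic window limits (pure real analysis): `C T` (`0 < T < T₁`) continuous,
`|C T t| ≤ B T²` (`t ≥ 0`), `K ∈ L¹(0,∞)`, `κ := ∫₀^∞ K > 0`, and the WINDOW LIMITS
`∫_{δ/T²}^{M/T²} C T → ∫_δ^M K` (`T ↓ 0`) for all `0 < δ ≤ M` give `a₀, ν₀ > 0` with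
`a₀ ≤ ∫₀^∞ e^{-νT²t} C T t dt` for `ν ∈ (0, ν₀]` and `T < T₀(ν)`. WHY: the bridge from route
KineticCorner's finite-window kinetic limit (shape of `KineticLimit`, stmt-3431) to the time-side
Abel floor T of the line's Poisson sandwich.

PROOF. Substitute `τ = T² t` (`f T τ := (T²)⁻¹ C T (τ/T²)`, `|f T| ≤ B`; `abelFloor_of_windowLimits_scaled`
⟹ the stub). Abel–Cesàro identity by parts on `(0,∞)`: `∫₀^∞ e^{-ντ} g = ∫₀^∞ ν e^{-νs} (∫₀ˢ g) ds`
(`laplace_eq_integral_primitive`). Window limits ⟹ `∫₀ˢ f T → ∫₀ˢ K` for every `s > 0` (head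
`(0,δ]`: `≤ Bδ`, continuity of the primitive of `K` at `0`); dominated convergence in `T` (bound
`ν B s e^{-νs}`). Finally `∫₀^∞ ν e^{-νs} (∫₀ˢ K) ds = ∫₀^∞ e^{-u} (∫₀^{u/ν} K) du → κ` (`ν ↓ 0`,
dominated convergence, `tendsto_abelMean_primitive`): `> κ/2` for `ν ≤ ν₀`, so the Abel mean of `f T`
is `> κ/4 =: a₀` for `T` small.
-/
noncomputable section

open MeasureTheory Filter Set
open scoped Topology

namespace Summit.AtomisticToContinuum.FouriersLaw.Theorems.DrudeDissolution.NaturalScalePoissonSandwich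

/-- Unpacking an eventual property at `0⁺` into an explicit threshold. [folklore] -/
theorem exists_forall_of_eventually_nhdsGT {p : ℝ → Prop} (h : ∀ᶠ x in 𝓝[>] (0 : ℝ), p x) :
    ∃ r : ℝ, 0 < r ∧ ∀ x : ℝ, 0 < x → x < r → p x := by
  rw [eventually_nhdsWithin_iff, Metric.eventually_nhds_iff] at h
  obtain ⟨ε, hε, h⟩ := h
  refine ⟨ε, hε, fun x hx hxε => h ?_ hx⟩
  rwa [Real.dist_eq, sub_zero, abs_of_pos hx]

/-- `0 < x < r` holds eventually at `0⁺` (`r > 0`). [folklore] -/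
theorem eventually_nhdsGT_pos_lt {r : ℝ} (hr : 0 < r) :
    ∀ᶠ x in 𝓝[>] (0 : ℝ), 0 < x ∧ x < r := by
  filter_upwards [eventually_mem_nhdsWithin (a := (0 : ℝ)) (s := Ioi 0),
    (eventually_lt_nhds hr).filter_mono nhdsWithin_le_nhds] with x hx hx'
  exact ⟨hx, hx'⟩

/-- `s ↦ s e^{-νs}` is integrable on `(0,∞)` for `ν > 0` (`Γ(2)`). [folklore] -/
theorem integrableOn_id_mul_exp_neg_mul {ν : ℝ} (hν : 0 < ν) :
    IntegrableOn (fun s : ℝ => s * Real.exp (-(ν * s))) (Ioi 0) := by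
  have h := integrableOn_rpow_mul_exp_neg_mul_rpow (s := 1) (p := 1) (by norm_num) le_rfl hν
  refine h.congr_fun (fun t _ => ?_) measurableSet_Ioi
  simp only [Real.rpow_one, neg_mul]

/-- `|∫₀ˢ g| ≤ B s` when `|g| ≤ B` on `[0,∞)` and `s ≥ 0`. [folklore] -/
theorem abs_primitive_le {g : ℝ → ℝ} {B s : ℝ} (hB : ∀ τ : ℝ, 0 ≤ τ → |g τ| ≤ B)
    (hs : 0 ≤ s) : |∫ u in (0 : ℝ)..s, g u| ≤ B * s := by
  have h : ‖∫ u in (0 : ℝ)..s, g u‖ ≤ B * |s - 0| :=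
    intervalIntegral.norm_integral_le_of_norm_le_const fun x hx => by
      rw [uIoc_of_le hs] at hx
      exact (Real.norm_eq_abs _).trans_le (hB x hx.1.le)
  rwa [sub_zero, abs_of_nonneg hs, Real.norm_eq_abs] at h

/-- `‖∫₀ᵇ K‖ ≤ ∫₀^∞ ‖K‖` for `b ≥ 0`. [folklore] -/
theorem norm_primitive_le {K : ℝ → ℝ} (hK : Integrable K) {b : ℝ} (hb : 0 ≤ b) :
    ‖∫ u in (0 : ℝ)..b, K u‖ ≤ ∫ u in Ioi (0 : ℝ), ‖K u‖ := by
  rw [intervalIntegral.integral_of_le hb]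
  exact (norm_integral_le_integral_norm _).trans
    (setIntegral_mono_set hK.norm.integrableOn (ae_of_all _ fun x => norm_nonneg _)
      (Ioc_subset_Ioi_self : Ioc (0 : ℝ) b ⊆ Ioi 0).eventuallyLE)

/-- **Abel–Cesàro identity.** For `g` continuous with `|g| ≤ B` on `[0,∞)` and `ν > 0`:
`∫₀^∞ e^{-ντ} g(τ) dτ = ∫₀^∞ ν e^{-νs} (∫₀ˢ g) ds` (integration by parts on `(0,∞)`; the boundary
terms vanish because `|∫₀ˢ g| ≤ Bs`). [folklore] -/
theorem laplace_eq_integral_primitive {g : ℝ → ℝ} {B ν : ℝ} (hg : Continuous g)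
    (hB : ∀ τ : ℝ, 0 ≤ τ → |g τ| ≤ B) (hν : 0 < ν) :
    ∫ τ in Ioi (0 : ℝ), Real.exp (-(ν * τ)) * g τ =
      ∫ s in Ioi (0 : ℝ), ν * Real.exp (-(ν * s)) * ∫ u in (0 : ℝ)..s, g u := by
  have hVc : Continuous fun x : ℝ => ∫ u in (0 : ℝ)..x, g u :=
    intervalIntegral.continuous_primitive (fun a b => hg.intervalIntegrable a b) 0
  have hec : Continuous fun x : ℝ => Real.exp (-(ν * x)) := by fun_prop
  -- derivatives
  have hu : ∀ x ∈ Ioi (0 : ℝ),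
      HasDerivAt (fun y : ℝ => Real.exp (-(ν * y))) (-ν * Real.exp (-(ν * x))) x := by
    intro x _
    have h : HasDerivAt (fun y : ℝ => Real.exp (-(ν * y)))
        (Real.exp (-(ν * x)) * (-(ν * 1))) x :=
      (((hasDerivAt_id' x).const_mul ν).neg).exp
    exact h.congr_deriv (by ring)
  have hv : ∀ x ∈ Ioi (0 : ℝ),
      HasDerivAt (fun y : ℝ => ∫ u in (0 : ℝ)..y, g u) (g x) x :=
    fun x _ => (hg.integral_hasStrictDerivAt 0 x).hasDerivAt
  -- integrability of the two products
  have huv' : IntegrableOn (fun x : ℝ => Real.exp (-(ν * x)) * g x) (Ioi 0) := by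
    have he : IntegrableOn (fun x : ℝ => Real.exp (-(ν * x))) (Ioi 0) := by
      simpa only [neg_mul] using exp_neg_integrableOn_Ioi 0 hν
    refine Integrable.mul_bdd (c := B) he.integrable hg.aestronglyMeasurable ?_
    rw [ae_restrict_iff' measurableSet_Ioi]
    exact ae_of_all _ fun x hx => by
      rw [Real.norm_eq_abs]
      exact hB x (le_of_lt hx)
  have hu'v : IntegrableOn
      (fun x : ℝ => -ν * Real.exp (-(ν * x)) * ∫ u in (0 : ℝ)..x, g u) (Ioi 0) := by
    refine Integrable.mono'
      (Integrable.const_mul (integrableOn_id_mul_exp_neg_mul hν).integrable (ν * B))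
      ((continuous_const.fun_mul hec).fun_mul hVc).aestronglyMeasurable ?_
    rw [ae_restrict_iff' measurableSet_Ioi]
    refine ae_of_all _ fun x hx => ?_
    have hx0 : 0 < x := hx
    rw [Real.norm_eq_abs, abs_mul, abs_mul, abs_neg, abs_of_pos hν, abs_of_pos (Real.exp_pos _)]
    calc ν * Real.exp (-(ν * x)) * |∫ u in (0 : ℝ)..x, g u|
        ≤ ν * Real.exp (-(ν * x)) * (B * x) := by
          gcongr
          exact abs_primitive_le hB hx0.le
      _ = ν * B * (x * Real.exp (-(ν * x))) := by ring
  -- boundary terms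
  have h0 : Tendsto (fun x : ℝ => Real.exp (-(ν * x)) * ∫ u in (0 : ℝ)..x, g u)
      (𝓝[>] 0) (𝓝 0) := by
    have h : Tendsto (fun x : ℝ => Real.exp (-(ν * x)) * ∫ u in (0 : ℝ)..x, g u) (𝓝 0)
        (𝓝 (Real.exp (-(ν * 0)) * ∫ u in (0 : ℝ)..0, g u)) := (hec.fun_mul hVc).tendsto 0
    rw [intervalIntegral.integral_same, mul_zero] at h
    exact h.mono_left nhdsWithin_le_nhds
  have hinf : Tendsto (fun x : ℝ => Real.exp (-(ν * x)) * ∫ u in (0 : ℝ)..x, g u)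
      atTop (𝓝 0) := by
    have h1 : Tendsto (fun x : ℝ => B * (x ^ (1 : ℝ) * Real.exp (-ν * x))) atTop (𝓝 0) := by
      simpa only [mul_zero] using
        (tendsto_rpow_mul_exp_neg_mul_atTop_nhds_zero 1 ν hν).const_mul B
    refine squeeze_zero_norm' ?_ h1
    filter_upwards [eventually_ge_atTop (0 : ℝ)] with x hx
    rw [Real.rpow_one, neg_mul, Real.norm_eq_abs, abs_mul, abs_of_pos (Real.exp_pos _)]
    calc Real.exp (-(ν * x)) * |∫ u in (0 : ℝ)..x, g u|
        ≤ Real.exp (-(ν * x)) * (B * x) := by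
          gcongr
          exact abs_primitive_le hB hx
      _ = B * (x * Real.exp (-(ν * x))) := by ring
  have hibp := integral_Ioi_mul_deriv_eq_deriv_mul hu hv huv' hu'v h0 hinf
  rw [hibp, sub_self, zero_sub, ← integral_neg]
  refine integral_congr_ae (ae_of_all _ fun x => ?_)
  ring

/-- Window limits give limits of the primitives: `∫₀ˢ f_T → ∫₀ˢ K` as `T ↓ 0`, for every `s > 0`
(head `(0, δ]`: `|∫₀^δ f_T| ≤ Bδ` and `∫₀^δ K → 0` as `δ ↓ 0`). [folklore] -/
theorem tendsto_primitive_of_windowLimits {f : ℝ → ℝ → ℝ} {K : ℝ → ℝ} {B T₁ : ℝ}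
    (hT₁ : 0 < T₁) (hK : Integrable K)
    (hf : ∀ T : ℝ, 0 < T → T < T₁ → Continuous (f T))
    (hB : ∀ T : ℝ, 0 < T → T < T₁ → ∀ τ : ℝ, 0 ≤ τ → |f T τ| ≤ B)
    (hwin : ∀ δ M e : ℝ, 0 < δ → δ ≤ M → 0 < e → ∃ T₀ : ℝ, 0 < T₀ ∧ ∀ T : ℝ, 0 < T → T < T₀ →
        |(∫ t in δ..M, f T t) - ∫ τ in δ..M, K τ| ≤ e)
    {s : ℝ} (hs : 0 < s) :
    Tendsto (fun T : ℝ => ∫ u in (0 : ℝ)..s, f T u) (𝓝[>] 0)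
      (𝓝 (∫ u in (0 : ℝ)..s, K u)) := by
  have hB0 : 0 ≤ B :=
    (abs_nonneg _).trans (hB (T₁ / 2) (by positivity) (by linarith) 0 le_rfl)
  rw [Metric.tendsto_nhdsWithin_nhds]
  intro ε hε
  -- the primitive of `K` is continuous at `0`
  have hKc : Continuous fun b : ℝ => ∫ u in (0 : ℝ)..b, K u := hK.continuous_primitive 0
  obtain ⟨δ₁, hδ₁, hKδ⟩ := Metric.continuous_iff.mp hKc 0 (ε / 4) (by positivity)
  -- choice of the head length `δ`
  obtain ⟨δ, hδ0, hδs, hδ1, hδB⟩ : ∃ δ : ℝ, 0 < δ ∧ δ ≤ s ∧ δ < δ₁ ∧ B * δ ≤ ε / 4 := by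
    refine ⟨min (min s (δ₁ / 2)) (ε / (4 * (B + 1))), ?_, ?_, ?_, ?_⟩
    · positivity
    · exact (min_le_left _ _).trans (min_le_left _ _)
    · calc min (min s (δ₁ / 2)) (ε / (4 * (B + 1)))
          ≤ δ₁ / 2 := (min_le_left _ _).trans (min_le_right _ _)
        _ < δ₁ := by linarith
    · calc B * min (min s (δ₁ / 2)) (ε / (4 * (B + 1)))
          ≤ B * (ε / (4 * (B + 1))) := by
            gcongr
            exact min_le_right _ _
        _ ≤ ε / 4 := by
            rw [mul_div_assoc', div_le_div_iff₀ (by positivity) (by positivity)]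
            nlinarith
  obtain ⟨T₀, hT₀, hw⟩ := hwin δ s (ε / 4) hδ0 hδs (by positivity)
  refine ⟨min T₀ T₁, by positivity, fun T hT hTd => ?_⟩
  have hT0 : 0 < T := hT
  rw [Real.dist_eq, sub_zero, abs_of_pos hT0] at hTd
  have hTT₀ : T < T₀ := lt_of_lt_of_le hTd (min_le_left _ _)
  have hTT₁ : T < T₁ := lt_of_lt_of_le hTd (min_le_right _ _)
  have hfi := fun a b : ℝ => (hf T hT0 hTT₁).intervalIntegrable (μ := volume) a b
  rw [← intervalIntegral.integral_add_adjacent_intervals (hfi 0 δ) (hfi δ s), Real.dist_eq,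
    ← intervalIntegral.integral_add_adjacent_intervals hK.intervalIntegrable hK.intervalIntegrable]
  have h1 : |∫ u in (0 : ℝ)..δ, f T u| ≤ ε / 4 :=
    (abs_primitive_le (hB T hT0 hTT₁) hδ0.le).trans hδB
  have h2 : |∫ u in (0 : ℝ)..δ, K u| < ε / 4 := by
    have := hKδ δ (by rwa [Real.dist_eq, sub_zero, abs_of_pos hδ0])
    rwa [intervalIntegral.integral_same, Real.dist_eq, sub_zero] at this
  have heq : (∫ u in (0 : ℝ)..δ, f T u) + (∫ u in δ..s, f T u) -
      ((∫ u in (0 : ℝ)..δ, K u) + ∫ u in δ..s, K u) =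
      (∫ u in (0 : ℝ)..δ, f T u) + -(∫ u in (0 : ℝ)..δ, K u) +
        ((∫ u in δ..s, f T u) - ∫ u in δ..s, K u) := by ring
  rw [heq]
  refine (abs_add_three _ _ _).trans_lt ?_
  rw [abs_neg]
  linarith [hw T hT0 hTT₀]

/-- Dominated convergence in `T`: the Abel means `∫₀^∞ ν e^{-νs} (∫₀ˢ f_T) ds` converge to
`∫₀^∞ ν e^{-νs} (∫₀ˢ K) ds` as `T ↓ 0` (bound `ν B s e^{-νs}`). [folklore] -/
theorem tendsto_integral_primitive_of_windowLimits {f : ℝ → ℝ → ℝ} {K : ℝ → ℝ} {B T₁ : ℝ}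
    (hT₁ : 0 < T₁) (hK : Integrable K)
    (hf : ∀ T : ℝ, 0 < T → T < T₁ → Continuous (f T))
    (hB : ∀ T : ℝ, 0 < T → T < T₁ → ∀ τ : ℝ, 0 ≤ τ → |f T τ| ≤ B)
    (hwin : ∀ δ M e : ℝ, 0 < δ → δ ≤ M → 0 < e → ∃ T₀ : ℝ, 0 < T₀ ∧ ∀ T : ℝ, 0 < T → T < T₀ →
        |(∫ t in δ..M, f T t) - ∫ τ in δ..M, K τ| ≤ e)
    {ν : ℝ} (hν : 0 < ν) :
    Tendsto (fun T : ℝ => ∫ s in Ioi (0 : ℝ), ν * Real.exp (-(ν * s)) * ∫ u in (0 : ℝ)..s, f T u)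
      (𝓝[>] 0) (𝓝 (∫ s in Ioi (0 : ℝ), ν * Real.exp (-(ν * s)) * ∫ u in (0 : ℝ)..s, K u)) := by
  have hev : ∀ᶠ T in 𝓝[>] (0 : ℝ), 0 < T ∧ T < T₁ := eventually_nhdsGT_pos_lt hT₁
  have hec : Continuous fun s : ℝ => ν * Real.exp (-(ν * s)) := by fun_prop
  refine tendsto_integral_filter_of_dominated_convergence
    (fun s => ν * B * (s * Real.exp (-(ν * s)))) ?_ ?_ ?_ ?_
  · filter_upwards [hev] with T hT
    have hVc : Continuous fun x : ℝ => ∫ u in (0 : ℝ)..x, f T u :=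
      intervalIntegral.continuous_primitive
        (fun a b => (hf T hT.1 hT.2).intervalIntegrable a b) 0
    exact (hec.fun_mul hVc).aestronglyMeasurable
  · filter_upwards [hev] with T hT
    rw [ae_restrict_iff' measurableSet_Ioi]
    refine ae_of_all _ fun s hs => ?_
    have hs0 : 0 < s := hs
    rw [Real.norm_eq_abs, abs_mul, abs_mul, abs_of_pos hν, abs_of_pos (Real.exp_pos _)]
    calc ν * Real.exp (-(ν * s)) * |∫ u in (0 : ℝ)..s, f T u|
        ≤ ν * Real.exp (-(ν * s)) * (B * s) := by
          gcongr
          exact abs_primitive_le (hB T hT.1 hT.2) hs0.le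
      _ = ν * B * (s * Real.exp (-(ν * s))) := by ring
  · exact Integrable.const_mul (integrableOn_id_mul_exp_neg_mul hν).integrable (ν * B)
  · rw [ae_restrict_iff' measurableSet_Ioi]
    refine ae_of_all _ fun s hs => ?_
    exact (tendsto_primitive_of_windowLimits hT₁ hK hf hB hwin hs).const_mul _

/-- **The limit `ν ↓ 0`.** `∫₀^∞ ν e^{-νs} (∫₀ˢ K) ds → ∫₀^∞ K` as `ν ↓ 0` for `K ∈ L¹`
(substitute `u = νs`; dominated convergence with the bound `e^{-u} ‖K‖₁`). [folklore] -/
theorem tendsto_abelMean_primitive {K : ℝ → ℝ} (hK : Integrable K) :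
    Tendsto (fun ν : ℝ => ∫ s in Ioi (0 : ℝ), ν * Real.exp (-(ν * s)) * ∫ u in (0 : ℝ)..s, K u)
      (𝓝[>] 0) (𝓝 (∫ u in Ioi (0 : ℝ), K u)) := by
  have h𝒦c : Continuous fun s : ℝ => ∫ u in (0 : ℝ)..s, K u := hK.continuous_primitive 0
  -- the substitution `u = ν s`
  have hsub : ∀ ν : ℝ, 0 < ν →
      ∫ s in Ioi (0 : ℝ), ν * Real.exp (-(ν * s)) * ∫ u in (0 : ℝ)..s, K u =
        ∫ x in Ioi (0 : ℝ), Real.exp (-x) * ∫ u in (0 : ℝ)..(x / ν), K u := by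
    intro ν hν
    have h : ∫ x in Ioi (0 : ℝ), Real.exp (-(ν * x)) * ∫ u in (0 : ℝ)..(ν * x / ν), K u =
        ν⁻¹ • ∫ x in Ioi (ν * 0), Real.exp (-x) * ∫ u in (0 : ℝ)..(x / ν), K u :=
      integral_comp_mul_left_Ioi (fun x : ℝ => Real.exp (-x) * ∫ u in (0 : ℝ)..(x / ν), K u) 0 hν
    rw [mul_zero, smul_eq_mul] at h
    have h' : ∫ x in Ioi (0 : ℝ), Real.exp (-(ν * x)) * ∫ u in (0 : ℝ)..x, K u =
        ν⁻¹ * ∫ x in Ioi (0 : ℝ), Real.exp (-x) * ∫ u in (0 : ℝ)..(x / ν), K u := by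
      rw [← h]
      refine setIntegral_congr_fun measurableSet_Ioi fun x _ => ?_
      rw [mul_div_cancel_left₀ x hν.ne']
    calc ∫ s in Ioi (0 : ℝ), ν * Real.exp (-(ν * s)) * ∫ u in (0 : ℝ)..s, K u
        = ν * ∫ s in Ioi (0 : ℝ), Real.exp (-(ν * s)) * ∫ u in (0 : ℝ)..s, K u := by
          rw [← integral_const_mul]
          refine setIntegral_congr_fun measurableSet_Ioi fun x _ => ?_
          ring
      _ = ∫ x in Ioi (0 : ℝ), Real.exp (-x) * ∫ u in (0 : ℝ)..(x / ν), K u := by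
          rw [h', ← mul_assoc, mul_inv_cancel₀ hν.ne', one_mul]
  -- dominated convergence in `ν`
  have hlim : Tendsto (fun ν : ℝ => ∫ x in Ioi (0 : ℝ), Real.exp (-x) * ∫ u in (0 : ℝ)..(x / ν), K u)
      (𝓝[>] 0) (𝓝 (∫ x in Ioi (0 : ℝ), Real.exp (-x) * ∫ u in Ioi (0 : ℝ), K u)) := by
    refine tendsto_integral_filter_of_dominated_convergence
      (fun x => Real.exp (-x) * ∫ u in Ioi (0 : ℝ), ‖K u‖) ?_ ?_ ?_ ?_
    · filter_upwards with ν
      have hc : Continuous fun x : ℝ => ∫ u in (0 : ℝ)..(x / ν), K u :=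
        h𝒦c.comp' (continuous_id'.div_const ν)
      have hc' : Continuous fun x : ℝ => Real.exp (-x) * ∫ u in (0 : ℝ)..(x / ν), K u :=
        (Real.continuous_exp.comp' continuous_neg).fun_mul hc
      exact hc'.aestronglyMeasurable
    · filter_upwards [eventually_mem_nhdsWithin (a := (0 : ℝ)) (s := Ioi 0)] with ν hν
      rw [ae_restrict_iff' measurableSet_Ioi]
      refine ae_of_all _ fun x hx => ?_
      rw [norm_mul, Real.norm_of_nonneg (Real.exp_pos _).le]
      gcongr
      exact norm_primitive_le hK (div_nonneg (le_of_lt hx) (le_of_lt hν))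
    · exact Integrable.mul_const (integrableOn_exp_neg_Ioi 0).integrable _
    · rw [ae_restrict_iff' measurableSet_Ioi]
      refine ae_of_all _ fun x hx => ?_
      have hx0 : 0 < x := hx
      have ht : Tendsto (fun ν : ℝ => x / ν) (𝓝[>] 0) atTop := by
        simp_rw [div_eq_mul_inv]
        exact tendsto_inv_nhdsGT_zero.const_mul_atTop hx0
      exact (intervalIntegral_tendsto_integral_Ioi 0 hK.integrableOn ht).const_mul _
  rw [integral_mul_const, integral_exp_neg_Ioi_zero, one_mul] at hlim
  refine hlim.congr' ?_
  filter_upwards [eventually_mem_nhdsWithin (a := (0 : ℝ)) (s := Ioi 0)] with ν hν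
  exact (hsub ν hν).symm

/-- **Abel floor from window limits, kinetic variable.** For a family `f T` (`0 < T < T₁`) of
continuous functions with `|f T| ≤ B` on `[0,∞)` whose window integrals `∫_δ^M f T` converge to
`∫_δ^M K` (`T ↓ 0`) for all `0 < δ ≤ M`, `K ∈ L¹(ℝ)`, `∫₀^∞ K > 0`: there are `a₀, ν₀ > 0` with
`a₀ ≤ ∫₀^∞ e^{-ντ} f T τ dτ` for `ν ∈ (0, ν₀]` and `T < T₀(ν)`. [folklore] -/
theorem abelFloor_of_windowLimits_scaled {f : ℝ → ℝ → ℝ} {K : ℝ → ℝ} {B T₁ : ℝ}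
    (hT₁ : 0 < T₁) (hK : Integrable K) (hκ : 0 < ∫ τ in Ioi (0 : ℝ), K τ)
    (hf : ∀ T : ℝ, 0 < T → T < T₁ → Continuous (f T))
    (hB : ∀ T : ℝ, 0 < T → T < T₁ → ∀ τ : ℝ, 0 ≤ τ → |f T τ| ≤ B)
    (hwin : ∀ δ M e : ℝ, 0 < δ → δ ≤ M → 0 < e → ∃ T₀ : ℝ, 0 < T₀ ∧ ∀ T : ℝ, 0 < T → T < T₀ →
        |(∫ t in δ..M, f T t) - ∫ τ in δ..M, K τ| ≤ e) :
    ∃ a₀ ν₀ : ℝ, 0 < a₀ ∧ 0 < ν₀ ∧ ∀ ν : ℝ, 0 < ν → ν ≤ ν₀ →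
      ∃ T₀ : ℝ, 0 < T₀ ∧ ∀ T : ℝ, 0 < T → T < T₀ →
        a₀ ≤ ∫ τ in Ioi (0 : ℝ), Real.exp (-(ν * τ)) * f T τ := by
  have h1 : ∀ᶠ ν in 𝓝[>] (0 : ℝ), (∫ τ in Ioi (0 : ℝ), K τ) / 2 <
      ∫ s in Ioi (0 : ℝ), ν * Real.exp (-(ν * s)) * ∫ u in (0 : ℝ)..s, K u :=
    (tendsto_abelMean_primitive hK).eventually (eventually_gt_nhds (by linarith))
  obtain ⟨ν₁, hν₁, hν₁'⟩ := exists_forall_of_eventually_nhdsGT h1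
  refine ⟨(∫ τ in Ioi (0 : ℝ), K τ) / 4, ν₁ / 2, by linarith, by linarith, fun ν hν hνle => ?_⟩
  have h2 : ∀ᶠ T in 𝓝[>] (0 : ℝ), (∫ τ in Ioi (0 : ℝ), K τ) / 4 <
      ∫ s in Ioi (0 : ℝ), ν * Real.exp (-(ν * s)) * ∫ u in (0 : ℝ)..s, f T u :=
    (tendsto_integral_primitive_of_windowLimits hT₁ hK hf hB hwin hν).eventually
      (eventually_gt_nhds (by linarith [hν₁' ν hν (by linarith)]))
  obtain ⟨T₂, hT₂, hT₂'⟩ :=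
    exists_forall_of_eventually_nhdsGT (h2.and (eventually_nhdsGT_pos_lt hT₁))
  refine ⟨T₂, hT₂, fun T hT hTT₂ => ?_⟩
  obtain ⟨hlt, -, hTT₁⟩ := hT₂' T hT hTT₂
  rw [laplace_eq_integral_primitive (hf T hT hTT₁) (hB T hT hTT₁) hν]
  exact hlt.le

/-- **B `stub_abelFloor_of_windowLimits` — ABEL SUMMATION OF KINETIC WINDOW LIMITS** (the registered
stub of line `natural-scale-poisson-sandwich`, verbatim). For continuous `C T` (`0 < T < T₁`) with
`|C T t| ≤ B T²` (`t ≥ 0`), `K ∈ L¹(0,∞)` with `∫₀^∞ K > 0`, and window limits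
`|∫_{δT⁻²}^{MT⁻²} C T − ∫_δ^M K| ≤ e` for `T < T₀(δ, M, e)` (`0 < δ ≤ M`, `e > 0`): there are
`a₀, ν₀ > 0` with `a₀ ≤ ∫₀^∞ e^{−νT²t} C T t dt` for `ν ∈ (0, ν₀]` and `T` small. Proof: substitute
`τ = T² t` and apply `abelFloor_of_windowLimits_scaled` to `(T²)⁻¹ C T (τ/T²)` and `𝟙_{(0,∞)} K`
(Abel regularisation as in Bonetto–Lebowitz–Rey-Bellet 2000 §6.3). [folklore] -/
theorem stub_abelFloor_of_windowLimits :
    ∀ (C : ℝ → ℝ → ℝ) (K : ℝ → ℝ) (B T₁ : ℝ), 0 < T₁ →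
      MeasureTheory.IntegrableOn K (Set.Ioi 0) → 0 < ∫ τ in Set.Ioi 0, K τ →
      (∀ T : ℝ, 0 < T → T < T₁ → Continuous (C T)) →
      (∀ T : ℝ, 0 < T → T < T₁ → ∀ t : ℝ, 0 ≤ t → |C T t| ≤ B * T ^ 2) →
      (∀ δ M e : ℝ, 0 < δ → δ ≤ M → 0 < e → ∃ T₀ : ℝ, 0 < T₀ ∧ ∀ T : ℝ, 0 < T → T < T₀ →
          |(∫ t in (δ / T ^ 2)..(M / T ^ 2), C T t) - ∫ τ in δ..M, K τ| ≤ e) →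
      ∃ a₀ ν₀ : ℝ, 0 < a₀ ∧ 0 < ν₀ ∧ ∀ ν : ℝ, 0 < ν → ν ≤ ν₀ →
        ∃ T₀ : ℝ, 0 < T₀ ∧ ∀ T : ℝ, 0 < T → T < T₀ →
          a₀ ≤ ∫ t in Set.Ioi (0 : ℝ), Real.exp (-(ν * T ^ 2 * t)) * C T t := by
  intro C K B T₁ hT₁ hKi hκ hC hCB hwin
  -- replace `K` by its restriction to `(0,∞)`, which is integrable on `ℝ`
  have hK₀i : Integrable ((Ioi (0 : ℝ)).indicator K) :=
    (integrable_indicator_iff measurableSet_Ioi).mpr hKi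
  have hK₀Ioi : ∫ τ in Ioi (0 : ℝ), (Ioi (0 : ℝ)).indicator K τ = ∫ τ in Ioi (0 : ℝ), K τ :=
    setIntegral_congr_fun measurableSet_Ioi fun x hx => indicator_of_mem hx K
  have hK₀int : ∀ δ M : ℝ, 0 < δ → δ ≤ M →
      ∫ τ in δ..M, (Ioi (0 : ℝ)).indicator K τ = ∫ τ in δ..M, K τ := by
    intro δ M hδ hδM
    rw [intervalIntegral.integral_of_le hδM, intervalIntegral.integral_of_le hδM]
    refine setIntegral_congr_fun measurableSet_Ioc fun x hx => ?_
    exact indicator_of_mem (show x ∈ Ioi (0 : ℝ) from lt_trans hδ hx.1) K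
  -- the rescaled family `f T τ = (T²)⁻¹ C T (τ / T²)`
  have hf : ∀ T : ℝ, 0 < T → T < T₁ →
      Continuous ((fun T τ : ℝ => (T ^ 2)⁻¹ * C T (τ / T ^ 2)) T) := by
    intro T hT hT'
    have hc : Continuous (C T) := hC T hT hT'
    show Continuous fun τ : ℝ => (T ^ 2)⁻¹ * C T (τ / T ^ 2)
    fun_prop
  have hB : ∀ T : ℝ, 0 < T → T < T₁ → ∀ τ : ℝ, 0 ≤ τ →
      |(fun T τ : ℝ => (T ^ 2)⁻¹ * C T (τ / T ^ 2)) T τ| ≤ B := by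
    intro T hT hT' τ hτ
    have hT2 : 0 < T ^ 2 := by positivity
    show |(T ^ 2)⁻¹ * C T (τ / T ^ 2)| ≤ B
    rw [abs_mul, abs_inv, abs_of_pos hT2, inv_mul_le_iff₀ hT2]
    have := hCB T hT hT' (τ / T ^ 2) (div_nonneg hτ hT2.le)
    linarith
  have hwin' : ∀ δ M e : ℝ, 0 < δ → δ ≤ M → 0 < e → ∃ T₀ : ℝ, 0 < T₀ ∧ ∀ T : ℝ, 0 < T → T < T₀ →
      |(∫ t in δ..M, (fun T τ : ℝ => (T ^ 2)⁻¹ * C T (τ / T ^ 2)) T t) -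
        ∫ τ in δ..M, (Ioi (0 : ℝ)).indicator K τ| ≤ e := by
    intro δ M e hδ hδM he
    obtain ⟨T₀, hT₀, h⟩ := hwin δ M e hδ hδM he
    refine ⟨T₀, hT₀, fun T hT hTT₀ => ?_⟩
    have hT2 : T ^ 2 ≠ 0 := by positivity
    have hsub : ∫ t in δ..M, (fun T τ : ℝ => (T ^ 2)⁻¹ * C T (τ / T ^ 2)) T t =
        ∫ t in (δ / T ^ 2)..(M / T ^ 2), C T t := by
      show ∫ t in δ..M, (T ^ 2)⁻¹ * C T (t / T ^ 2) = ∫ t in (δ / T ^ 2)..(M / T ^ 2), C T t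
      rw [intervalIntegral.integral_const_mul, intervalIntegral.integral_comp_div _ hT2,
        smul_eq_mul, ← mul_assoc, inv_mul_cancel₀ hT2, one_mul]
    rw [hsub, hK₀int δ M hδ hδM]
    exact h T hT hTT₀
  obtain ⟨a₀, ν₀, ha₀, hν₀, hmain⟩ :=
    abelFloor_of_windowLimits_scaled hT₁ hK₀i (by rwa [hK₀Ioi]) hf hB hwin'
  refine ⟨a₀, ν₀, ha₀, hν₀, fun ν hν hνle => ?_⟩
  obtain ⟨T₀, hT₀, h⟩ := hmain ν hν hνle
  refine ⟨T₀, hT₀, fun T hT hTT₀ => ?_⟩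
  have hT2 : 0 < T ^ 2 := by positivity
  -- undo the substitution `τ = T² t`
  have hs : ∫ x in Ioi (0 : ℝ), Real.exp (-(ν * (T ^ 2 * x))) * ((T ^ 2)⁻¹ * C T (T ^ 2 * x / T ^ 2)) =
      (T ^ 2)⁻¹ • ∫ x in Ioi (T ^ 2 * 0), Real.exp (-(ν * x)) * ((T ^ 2)⁻¹ * C T (x / T ^ 2)) :=
    integral_comp_mul_left_Ioi
      (fun τ : ℝ => Real.exp (-(ν * τ)) * ((T ^ 2)⁻¹ * C T (τ / T ^ 2))) 0 hT2
  rw [mul_zero, smul_eq_mul] at hs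
  have hpt : ∀ x : ℝ, Real.exp (-(ν * (T ^ 2 * x))) * ((T ^ 2)⁻¹ * C T (T ^ 2 * x / T ^ 2)) =
      (T ^ 2)⁻¹ * (Real.exp (-(ν * T ^ 2 * x)) * C T x) := by
    intro x
    rw [mul_div_cancel_left₀ x hT2.ne', show ν * (T ^ 2 * x) = ν * T ^ 2 * x by ring]
    ring
  simp_rw [hpt] at hs
  rw [integral_const_mul] at hs
  have key := mul_left_cancel₀ (inv_ne_zero hT2.ne') hs
  rw [key]
  exact h T hT hTT₀

end Summit.AtomisticToContinuum.FouriersLaw.Theorems.DrudeDissolution.NaturalScalePoissonSandwich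

end
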